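import Literature.MathematicalPhysics.QuantumFieldTheory.Balaban1983to89.B9Thm31SiteGsqSecondDecayReg335Y
import Literature.MathematicalPhysics.QuantumFieldTheory.Balaban1983to89.B9Eq346SecondLegAtPinsL2

/-!
# `Balaban1983to89.B9Eq346SecondLegAtCubesTorusL2` — T. Bałaban, *Propagators for lattice gauge theories in a background field*, Commun. Math. Phys. **99**
# (1985) 389–434 [Balaban1985BackgroundPropagators] Cor 3.6 p. 408 ∕ (3.46) p. 398 (the second-order member `‖hG′(U)∇\*_U∇\*_Uλ‖`) ∕ (3.87)–(3.90) pp. 408–410: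
# ★★★ **THE DECAYING SECOND-ORDER MEMBER `M_{h_□}G′_□(U)M_{h_□}∇\*_ν∇\*_μ` AT THE PARTITION OF RECORD `h_□ = hTY c` ON `□̃(c) = cubeDomY x c`, BLOCK TO BLOCK,
# WITH A MEMBER- AND □-UNIFORM CONSTANT — and the rows-18 schema `L2SecondLegs37` AT THE PINS under the located plaquette-window binder**

statement-level skeleton of published theorems with citation tags; proofs where landed; nothing here is a claim about the Yang–Mills mass gap

THE PRINT.  p. 398 (3.46), third line: *«‖hG′(U)∇\*_U∇\*_Uλ‖ ≤ B₀e^{−δ₀d(y,y′)}‖h‖‖λ‖»*; p. 408, Cor 3.6: the estimates of Thm 3.1 hold for `G′_□(U)` *«with constants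
independent of □»*; p. 408: *«We take the partition of unity {h_□} defined at the end of Sect. A in [4]»*; [4] p. 247: *«|∂h_□| ≤ O(1)(MLʲη)⁻¹»*, *«|Δh_□| ≤
O(1)(MLʲη)⁻²»*; [4] p. 235: `□̃` = the cube enlarged by the neighbouring big blocks (levels `j − 1 ≤ j(a) ≤ j + 1`); (3.35) p. 396 ∕ (3.69) p. 404: the plaquette
variables of the class are within `O(1)Mα₀(Lʲη)⁻²` of `1`.

WHY THIS FILE (cell `pub-ymgap`, Track A node N06 [B9], rows 18 of the N06 certificate: the Theorem-3.7 walk's `L²` legs).  The certificate displays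
`h36H ∋ L2SecondLegs37 (𝔬 x) (𝔡 x) 1 (H x) (S3 x) B₃ δ₀ U` (dag-n06-k `B9RWSums346SecondDiffGp.L2SecondLegs37.l5`: per cube `c` and directions `ν μ`,
`BlockBd blk blk ((M_{h_c}G′_cM_{h_c}) ∘ (Dsd ν ∘ Dsd μ)) (1_{S_c}·B₃·e^{−δd})`).  Its consumer + packaging at the pins is dag-n06-w7's `B9Eq346SecondLegAtPinsL2`
(§5 `l2SecondLegs37_memberY_of_hs_window`: a member- and □-UNIFORM 𝔸-level block-to-block bound `hHSuW`, holding under a per-member side condition `W x U c`,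
gives `∃ M₃ a₃ B₃ δ₃ > 0` with `L2SecondLegs37 𝔬 𝔡 R₀ H₀ (SblkY x bI) B₃ δ₃ U` in the certificate's prefix); its 𝔸-level producer at GENERAL `h`, `D` is
dag-n06-w1's `B9Thm31SiteGsqSecondDecayReg335Y.hs_block_sandwich_cdsS_cdsS_le` (file 32; constant `C₃(κ, κ₂, κ_b, ε_D, L^{j_D}, L^{−j′_D})`, NO power of `M`).
THIS FILE is the instantiation `h := hTY c`, `D := cubeDomY x c` and the uniformization of `C₃` (dag-n06-w7's successor trigger (t4)):
* §1 LEVEL ∕ SUPPORT BOOKKEEPING on `□̃(c)`: `lev_window_of_mem_cubeDomY` (`j(c) − 1 ≤ lev a ≤ (j(c) − 1) + 2` for the blocks of `□̃(c)`, so that with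
  `j′_D := j(c) − 1`, `j_D := j′_D + 2` one has `L^{j_D} = L²·L^{j′_D}` EXACTLY — `pow_window_eq`), `hTY_eq_zero_of_not_mem_cubeDomY`, `pow_window_le`
  (`L^{j_D} ≤ L·S_{j(c)}`, `S_j = M_h·L^{j+1}` the side of the big cube);
* §2 THE SIZES OF THE PARTITION OF RECORD IN SCALED FORM: `abs_hTY_shiftY_sub_le_scaled` (`|∂h_c| ≤ (5C₁L∕8)∕L^{j_D}`), `abs_hTY_second_diff_le_scaled`
  (`|∂∂h_c| ≤ (25C₂L²∕64)∕L^{2j_D}`), `abs_hTY_sub_le_sLipT` (block oscillation `≤ sLip`) — file 25 §R1 with `M_h ≥ 1` absorbed;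
* §3 ★★★ `hs_block_hTY_sandwich_cdsS_cdsS_le_window` — file 32 at the pins: for `λ` carried by the torus block `s`, every block `t`, every cube `c`, directions
  `ν μ`: `Σ_{z∈Δ(t)} HS((M_{h_c}G′_c(U)M_{h_c}∇\*_{U,ν}∇\*_{U,μ}λ)(z)) ≤ C₃ᵘ·(e^{δ₀((d_T(t,s)−m)∕(2L) − 1)})⁻²·‖λ‖²₁`, `m = (d+1)(4L+1) + 3`, `δ₀ = 1∕(4(d+2))`,
  `C₃ᵘ = (4∕3)(4 + 8(2560(d+1)a² + 1024(d+1)²b² + 512e²L⁸) + 3072L⁸ + 2048(d+1)²W² + 2(d+1)W(960 + 1536(d+1)a² + 2048(d+1)L⁸) + 256(d+1)L⁸(320 + 512(d+1)a²)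
  + 16384(d+1)²L¹⁶)`, `a = 5C₁L∕8`, `b = 25C₂L²∕64`, `e = sLip`, `W = (d+1)²w₀` — member- and □-UNIFORM (the pointwise window `ε z := Σ_{μν}‖U(∂p_{μν}(z)) − 1‖`,
  `ε_D := (d+1)²w₀∕L^{2j_D}`; every product `κ²L^{2j_D}`, `κ₂²L^{4j_D}`, `ε_DL^{2j_D}`, `L^{j_D}∕L^{j′_D}` of `C₃` cancels EXACTLY — `field_simp; ring`), UNDER the
  per-cube side condition «every plaquette variable within two lattice steps of `□̃(c)` is within `w₀∕L^{2j_D}` of `1`» (file 28∕32's `hF ∕ hεD ∕ hεD'` shape);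
* §4 ★★★ `l2SecondLegs37_memberY_window` — dag-n06-w7's §5 applied: `∃ M₃ a₃ B₃ δ₃ > 0`, in the certificate's prefix and for every member and configuration of
  the class satisfying the window at every cube, `L2SecondLegs37 𝔬 𝔡 R₀ H₀ (SblkY x bI) B₃ δ₃ U` at the pins.
HONEST SCOPE.  One instantiation + arithmetic over landed, kernel-checked files (dag-n06-w1 p625928, dag-n06-w7 p626406); nothing of [B9] beyond them is asserted.
The plaquette window near `□̃(c)` is NOT derived here: block-interior plaquettes are covered by the class (dag-n06-j `B9Eq335CoverageAtLettersY.
norm_holY_sub_one_le_of_reg335_interior`), big-block FACE plaquettes are not (`reg335_flipNegOne_of_uncovered`) — it stays a displayed hypothesis (the certificate's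
located binder) unless node00-def-Y rules a class∕domain amendment.  NON-VACUITY (A6): `U = 1`, `w₀ = 0`.  Count-neutral; N06 NOT discharged; K1 NOT closed; one
finite lattice at a time — nothing continuum ∕ OS ∕ mass gap ∕ Clay; the YM mass gap (Clay) is NOT proved by any of this — R4 closes the conditional finite-𝕋⁴ rung
`BalabanLadder.UV` only.  Cell `pub-ymgap` (HUMAN RULING D-0062), width seat `pub-ymgap-dag-n06-w1` (g5), 2026-08-28.  NEW file; 0 `def`; imports two BUILT modules.
-/

noncomputable section

namespace Literature.MathematicalPhysics.QuantumFieldTheory.Balaban1983to89.B9Eq346SecondLegAtCubesTorusL2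

open Literature.MathematicalPhysics.QuantumFieldTheory.Balaban1983to89
open Node00 B6KLevelCensusIndexV1 B6Geom246MultiLevelBox B6MultiLevelBoxOperator B6MultiLevelTorusOperator B6GlobalChartV1 B9BackgroundsKLevelV1
  B9Eq39Adjoint B6Geom246MultiLevelTorus B9Thm31SiteGsqSecondDecayReg335Y B9Eq346SecondLegAtPinsL2
open Literature.MathematicalPhysics.QuantumFieldTheory.Balaban1983to89.B9Ineq369CurvatureSmallAtLettersY (hs_nonneg)
open Literature.MathematicalPhysics.QuantumFieldTheory.Balaban1983to89.B9Thm311DeltaPrimePos (trIP_self_nonneg)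
open Literature.MathematicalPhysics.QuantumFieldTheory.Balaban1983to89.B9Thm311ReadingCoords (trIP)
open Literature.MathematicalPhysics.QuantumFieldTheory.Balaban1983to89.B9Thm37CubeCoverCommutators (cutMulY cutMulY_apply hTY hTY_apply one_le_Mh_and_P)
open Literature.MathematicalPhysics.QuantumFieldTheory.Balaban1983to89.B9Thm37CubeCoverCommutatorSizes (abs_hTY_shiftY_sub_le)
open Literature.MathematicalPhysics.QuantumFieldTheory.Balaban1983to89.B9Thm31SiteGsqRecordCutoffReg335Y (abs_hTY_le_one abs_hTY_second_diff_le' abs_hTY_sub_le_of_blkOf_eq)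
open Literature.MathematicalPhysics.QuantumFieldTheory.Balaban1983to89.B6Partition118KLevelFineSizes (C1F C1F_nonneg)
open Literature.MathematicalPhysics.QuantumFieldTheory.Balaban1983to89.B6Partition118KLevelFineSecond (C2F C2F_nonneg)
open Literature.MathematicalPhysics.QuantumFieldTheory.Balaban1983to89.B6Partition118KLevelTorusBinders (sLipT sLipT_nonneg)
open Literature.MathematicalPhysics.QuantumFieldTheory.Balaban1983to89.B6Cover236MultiLevelBlocks (cubes)
open Literature.MathematicalPhysics.QuantumFieldTheory.Balaban1983to89.B6Cover236QbigOverlapV1 (window_and_congr_of_mem_QbigT)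
open Literature.MathematicalPhysics.QuantumFieldTheory.Balaban1983to89.B6Partition118KLevelTorusCentral (QbigT)
open Literature.MathematicalPhysics.QuantumFieldTheory.Balaban1983to89.B9WalkLettersCoordsS (cubeBlksY cubeDomY SblkY hWalkY gsqcoS two_le_Mh four_le_P mem_cubeDomY_of_hTY_ne_zero)
open Literature.MathematicalPhysics.QuantumFieldTheory.Balaban1983to89.B9PinMembersKLevelV1 (MemberY geo9Y bg9Y reg335Y_iff)
open Literature.MathematicalPhysics.QuantumFieldTheory.Balaban1983to89.B6Ineq2142KLevelV1 (lvl β)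
open Literature.MathematicalPhysics.QuantumFieldTheory.Balaban1983to89.B9Ineq349SiteComposite (cdsSL etaS_pos)
open Literature.MathematicalPhysics.QuantumFieldTheory.Balaban1983to89.B9CoReadingCoords (coordOpK)
open Literature.MathematicalPhysics.QuantumFieldTheory.Balaban1983to89.B9CoReadingCoordsS (XSK blkSK sIK)
open Literature.MathematicalPhysics.QuantumFieldTheory.Balaban1983to89.B9CoReadingCoordsTranspose (TrIdx trBasis)
open Literature.MathematicalPhysics.QuantumFieldTheory.Balaban1983to89.B9Thm37Whole (Ops)
open Literature.MathematicalPhysics.QuantumFieldTheory.Balaban1983to89.B9RWSums346SecondDiffGp (DirOps37 L2SecondLegs37)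
open Literature.MathematicalPhysics.QuantumFieldTheory.Balaban1983to89.Node00.OpsYLocalInverse (GsqY)
open scoped Matrix Matrix.Norms.L2Operator

variable {d ℓ : ℕ} {hd : 1 ≤ d + 1} {hL : Odd (ℓ + 1) ∧ 1 < ℓ + 1} {b₀ b₁ : ℝ} {Mstar : ℕ}
variable (x : MemberY d ℓ hd hL b₀ b₁ Mstar) {N : ℕ} {G : Subgroup (Matrix (Fin N) (Fin N) ℂ)ˣ}

/-! ## §1 Level and support bookkeeping on `□̃(c)` -/

section Levels

/-- **THE LEVEL WINDOW OF `□̃(c)`**, in the form used below: every block of `cubeDomY x c` has level in `[j(c) − 1, (j(c) − 1) + 2]` (truncated subtraction;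
[4] p. 235: `j − 1 ≤ j(a) ≤ j + 1`, the tree's `window_and_congr_of_mem_QbigT`). [cite: Balaban1984PropagatorsII, p.235 («□̃»), (2.36) p.229, bookkeeping] -/
theorem lev_window_of_mem_cubeDomY (c : ↥(cubes x.toKIdx.D.toDomains)) {z : SiteY x.toKIdx} (hz : z ∈ cubeDomY x c) :
    c.1.1 - 1 ≤ (blkOf x.toKIdx.D.toDomains z).1.1 ∧ (blkOf x.toKIdx.D.toDomains z).1.1 ≤ c.1.1 - 1 + 2 := by
  unfold cubeDomY cubeBlksY at hz
  rw [Finset.mem_filter] at hz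
  have hmem : blkOf x.toKIdx.D.toDomains z ∈ QbigT x.toKIdx.D (one_le_Mh_and_P x.toKIdx).1 (four_le_P x) c := hz.2
  have hw := (window_and_congr_of_mem_QbigT x.toKIdx.D hL (two_le_Mh x) x.toKIdx.hR2 (one_le_Mh_and_P x.toKIdx).1 (four_le_P x) hmem).1
  omega

/-- `h_c` vanishes off `□̃(c)` (contrapositive of `mem_cubeDomY_of_hTY_ne_zero`). [cite: Balaban1984PropagatorsII, p.235, (2.134) p.247, bookkeeping] -/
theorem hTY_eq_zero_of_not_mem_cubeDomY (c : ↥(cubes x.toKIdx.D.toDomains)) {z : SiteY x.toKIdx} (hz : z ∉ cubeDomY x c) :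
    hTY x.toKIdx c z = 0 := by
  by_contra h
  exact hz (mem_cubeDomY_of_hTY_ne_zero x c h)

/-- `L^{(j−1)+2} = L²·L^{j−1}`. [cite: Balaban1984PropagatorsII, (2.36) p.229, bookkeeping] -/
theorem pow_window_eq (j : ℕ) : ((((ℓ + 1) ^ (j - 1 + 2) : ℕ) : ℝ)) = (((ℓ + 1 : ℕ) : ℝ)) ^ 2 * ((((ℓ + 1) ^ (j - 1) : ℕ) : ℝ)) := by
  push_cast
  ring

/-- `L^{(j−1)+2} ≤ L·S_j`, `S_j = M_h·L^{j+1}` the side of the big cube (`M_h ≥ 1`, `L ≥ 1`, `(j − 1) + 2 ≤ j + 2`).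
[cite: Balaban1984PropagatorsII, (2.36) p.229, p.247, bookkeeping] -/
theorem pow_window_le (j : ℕ) : ((((ℓ + 1) ^ (j - 1 + 2) : ℕ) : ℝ)) ≤ (((ℓ + 1 : ℕ) : ℝ)) * (bigSide ℓ x.toKIdx.Mh j : ℝ) := by
  have hMh : 1 ≤ x.toKIdx.Mh := (one_le_Mh_and_P x.toKIdx).1
  have h1 : (ℓ + 1) ^ (j - 1 + 2) ≤ (ℓ + 1) * bigSide ℓ x.toKIdx.Mh j := by
    unfold bigSide
    calc (ℓ + 1) ^ (j - 1 + 2) ≤ (ℓ + 1) ^ (j + 2) := Nat.pow_le_pow_right (Nat.succ_pos ℓ) (by omega)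
      _ = (ℓ + 1) * (1 * (ℓ + 1) ^ (j + 1)) := by ring
      _ ≤ (ℓ + 1) * (x.toKIdx.Mh * (ℓ + 1) ^ (j + 1)) := Nat.mul_le_mul_left _ (Nat.mul_le_mul_right _ hMh)
  exact_mod_cast h1

/-- `0 < L^{(j−1)+2}`. [cite: Balaban1984PropagatorsII, (2.36) p.229, bookkeeping] -/
theorem pow_window_pos (j : ℕ) : (0 : ℝ) < ((((ℓ + 1) ^ (j - 1 + 2) : ℕ) : ℝ)) :=
  Nat.cast_pos.2 (pow_pos (Nat.succ_pos ℓ) _)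

end Levels

/-! ## §2 The sizes of the partition of record `h_c = hTY c` in scaled form -/

section Sizes

/-- **ONE LATTICE STEP COSTS `h_c` AT MOST `(5C₁L∕8)∕L^{j_D}`**, `j_D = (j(c) − 1) + 2` (file 25 §R1 ∕ `abs_hTY_shiftY_sub_le`: `≤ C₁∕((8∕5)S_j)`, and `L^{j_D} ≤ L·S_j`).
[cite: Balaban1984PropagatorsII, p.247 («|∂h_□| ≤ O(1)(MLʲη)⁻¹»); Balaban1985BackgroundPropagators, Cor 3.6 p.408 («constants independent of □»)] -/
theorem abs_hTY_shiftY_sub_le_scaled (c : ↥(cubes x.toKIdx.D.toDomains)) (μ : Fin (d + 1)) (z : SiteY x.toKIdx) :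
    |hTY x.toKIdx c (shiftY x.toKIdx μ z) - hTY x.toKIdx c z|
      ≤ 5 / 8 * C1F d ℓ * (((ℓ + 1 : ℕ) : ℝ)) / ((((ℓ + 1) ^ (c.1.1 - 1 + 2) : ℕ) : ℝ)) := by
  have h0 := abs_hTY_shiftY_sub_le x.toKIdx c μ z
  have hS : (0 : ℝ) < (bigSide ℓ x.toKIdx.Mh c.1.1 : ℝ) := Nat.cast_pos.2 (one_le_bigSide (one_le_Mh_and_P x.toKIdx).1 _)
  have hP := pow_window_pos (ℓ := ℓ) c.1.1
  refine h0.trans ?_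
  rw [div_le_div_iff₀ (mul_pos (by norm_num) hS) hP]
  calc C1F d ℓ * ((((ℓ + 1) ^ (c.1.1 - 1 + 2) : ℕ) : ℝ)) ≤ C1F d ℓ * ((((ℓ + 1 : ℕ) : ℝ)) * (bigSide ℓ x.toKIdx.Mh c.1.1 : ℝ)) :=
        mul_le_mul_of_nonneg_left (pow_window_le x c.1.1) (C1F_nonneg d ℓ)
    _ = 5 / 8 * C1F d ℓ * (((ℓ + 1 : ℕ) : ℝ)) * (8 / 5 * (bigSide ℓ x.toKIdx.Mh c.1.1 : ℝ)) := by ring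

/-- **THE AXIS SECOND DIFFERENCE OF `h_c` IS AT MOST `(25C₂L²∕64)∕L^{2j_D}`** (file 25 §R1 `abs_hTY_second_diff_le'`: `≤ C₂∕((8∕5)S_j)²`).
[cite: Balaban1984PropagatorsII, p.247 («|Δh_□| ≤ O(1)(MLʲη)⁻²»); Balaban1985BackgroundPropagators, (3.88) p.409] -/
theorem abs_hTY_second_diff_le_scaled (c : ↥(cubes x.toKIdx.D.toDomains)) (μ : Fin (d + 1)) (z : SiteY x.toKIdx) :
    |hTY x.toKIdx c (shiftY x.toKIdx μ z) + hTY x.toKIdx c ((shiftY x.toKIdx μ).symm z) - 2 * hTY x.toKIdx c z|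
      ≤ 25 / 64 * C2F d ℓ * (((ℓ + 1 : ℕ) : ℝ)) ^ 2 / ((((ℓ + 1) ^ (c.1.1 - 1 + 2) : ℕ) : ℝ)) ^ 2 := by
  have h0 := abs_hTY_second_diff_le' x.toKIdx c μ z
  have hS : (0 : ℝ) < (bigSide ℓ x.toKIdx.Mh c.1.1 : ℝ) := Nat.cast_pos.2 (one_le_bigSide (one_le_Mh_and_P x.toKIdx).1 _)
  have hP := pow_window_pos (ℓ := ℓ) c.1.1
  refine h0.trans ?_
  rw [div_le_div_iff₀ (pow_pos (mul_pos (by norm_num) hS) 2) (pow_pos hP 2)]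
  have hsq : ((((ℓ + 1) ^ (c.1.1 - 1 + 2) : ℕ) : ℝ)) ^ 2 ≤ ((((ℓ + 1 : ℕ) : ℝ)) * (bigSide ℓ x.toKIdx.Mh c.1.1 : ℝ)) ^ 2 :=
    pow_le_pow_left₀ hP.le (pow_window_le x c.1.1) 2
  calc C2F d ℓ * ((((ℓ + 1) ^ (c.1.1 - 1 + 2) : ℕ) : ℝ)) ^ 2 ≤ C2F d ℓ * ((((ℓ + 1 : ℕ) : ℝ)) * (bigSide ℓ x.toKIdx.Mh c.1.1 : ℝ)) ^ 2 :=
        mul_le_mul_of_nonneg_left hsq (C2F_nonneg d ℓ)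
    _ = 25 / 64 * C2F d ℓ * (((ℓ + 1 : ℕ) : ℝ)) ^ 2 * (8 / 5 * (bigSide ℓ x.toKIdx.Mh c.1.1 : ℝ)) ^ 2 := by ring

/-- **INSIDE ONE BLOCK `h_c` OSCILLATES BY AT MOST `sLip`** (file 25 §R1 `abs_hTY_sub_le_of_blkOf_eq`: `≤ sLip∕(L·M_h)`, and `L·M_h ≥ 1`).
[cite: Balaban1984PropagatorsII, p.247; Balaban1985BackgroundPropagators, (3.88) p.409 (second line)] -/
theorem abs_hTY_sub_le_sLipT (c : ↥(cubes x.toKIdx.D.toDomains)) {z w : SiteY x.toKIdx} (hzw : blkOf x.toKIdx.D.toDomains w = blkOf x.toKIdx.D.toDomains z) :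
    |hTY x.toKIdx c z - hTY x.toKIdx c w| ≤ sLipT d ℓ := by
  have h0 := abs_hTY_sub_le_of_blkOf_eq x.toKIdx c hzw
  have hMh : (1 : ℝ) ≤ (x.toKIdx.Mh : ℝ) := by exact_mod_cast (one_le_Mh_and_P x.toKIdx).1
  have hL1 : (1 : ℝ) ≤ (ℓ : ℝ) + 1 := by linarith [Nat.cast_nonneg (α := ℝ) ℓ]
  have hM1 : (1 : ℝ) ≤ ((ℓ : ℝ) + 1) * x.toKIdx.Mh := by nlinarith
  exact h0.trans (div_le_self (sLipT_nonneg d ℓ) hM1)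

end Sizes

/-! ## §3 The decaying second-order member at the partition of record, block to block, uniform constant -/

section Main

/-- the uniformization identity: file 32's constant at `κ = a∕P`, `κ₂ = b∕P²`, `κ_b = e`, `ε_D = W∕P²`, `P = L²Q` is free of `P`, `Q`. [folklore] -/
private theorem const_identity (a b e W Lr Q D1 : ℝ) (hLr : Lr ≠ 0) (hQ : Q ≠ 0) :
    (4 / 3 * (4 + 4 * (2560 * D1 * (a / (Lr ^ 2 * Q)) ^ 2 * (Lr ^ 2 * Q) ^ 2
      + 1024 * (D1 * (b / (Lr ^ 2 * Q) ^ 2)) ^ 2 * ((Lr ^ 2 * Q) ^ 2) ^ 2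
      + 512 * e ^ 2 * ((Q ^ 2)⁻¹) ^ 2 * ((Lr ^ 2 * Q) ^ 2) ^ 2)
      + 512 * ((Q ^ 2)⁻¹) ^ 2 * ((Lr ^ 2 * Q) ^ 2) ^ 2
      + 1024 * D1 ^ 2 * (W / (Lr ^ 2 * Q) ^ 2) ^ 2 * ((Lr ^ 2 * Q) ^ 2) ^ 2
      + 2 * D1 * (W / (Lr ^ 2 * Q) ^ 2) * (320 * (Lr ^ 2 * Q) ^ 2 + 512 * D1 * (a / (Lr ^ 2 * Q)) ^ 2 * ((Lr ^ 2 * Q) ^ 2) ^ 2))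
      + 4 / 3 * (4 * (8 * D1 * (a / (Lr ^ 2 * Q)) ^ 2 * (2 * (160 * (Lr ^ 2 * Q) ^ 2)) + 4 * (D1 * (b / (Lr ^ 2 * Q) ^ 2)) ^ 2 * (256 * ((Lr ^ 2 * Q) ^ 2 * (Lr ^ 2 * Q) ^ 2)) + 2 * e ^ 2 * ((Q ^ 2)⁻¹ ^ 2 * (256 * ((Lr ^ 2 * Q) ^ 2 * (Lr ^ 2 * Q) ^ 2))))
      + 4 * (8 * D1 * (2 * Lr ^ 2 * Q⁻¹) ^ 2 * (2 * (2 * (160 * (Lr ^ 2 * Q) ^ 2) + 2 * D1 * (a / (Lr ^ 2 * Q)) ^ 2 * (256 * ((Lr ^ 2 * Q) ^ 2 * (Lr ^ 2 * Q) ^ 2)))) + 4 * (D1 * (2 * Lr ^ 4 * (Q ^ 2)⁻¹)) ^ 2 * (256 * ((Lr ^ 2 * Q) ^ 2 * (Lr ^ 2 * Q) ^ 2)) + 2 * (1 : ℝ) ^ 2 * ((Q ^ 2)⁻¹ ^ 2 * (256 * ((Lr ^ 2 * Q) ^ 2 * (Lr ^ 2 * Q) ^ 2))))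
      + 2 * ((Q ^ 2)⁻¹ ^ 2 * (256 * ((Lr ^ 2 * Q) ^ 2 * (Lr ^ 2 * Q) ^ 2)))
      + (D1 ^ 2 * (4 * ((W / (Lr ^ 2 * Q) ^ 2) ^ 2 * (256 * ((Lr ^ 2 * Q) ^ 2 * (Lr ^ 2 * Q) ^ 2))))
      + 2 * D1 * (W / (Lr ^ 2 * Q) ^ 2) * (2 * (2 * (160 * (Lr ^ 2 * Q) ^ 2) + 2 * D1 * (a / (Lr ^ 2 * Q)) ^ 2 * (256 * ((Lr ^ 2 * Q) ^ 2 * (Lr ^ 2 * Q) ^ 2))) + 2 * D1 * (2 * Lr ^ 2 * Q⁻¹) ^ 2 * (256 * ((Lr ^ 2 * Q) ^ 2 * (Lr ^ 2 * Q) ^ 2))))))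
    = 4 / 3 * (4 + 8 * (2560 * D1 * a ^ 2 + 1024 * D1 ^ 2 * b ^ 2 + 512 * e ^ 2 * Lr ^ 8) + 3072 * Lr ^ 8 + 2048 * D1 ^ 2 * W ^ 2
        + 2 * D1 * W * (960 + 1536 * D1 * a ^ 2 + 2048 * D1 * Lr ^ 8) + 256 * D1 * Lr ^ 8 * (320 + 512 * D1 * a ^ 2) + 16384 * D1 ^ 2 * Lr ^ 16) := by
  field_simp
  ring

set_option maxHeartbeats 400000 in
/-- ★★★ **THE SECOND-ORDER MEMBER `M_{h_c}G′_c(U)M_{h_c}∇\*_{U,ν}∇\*_{U,μ}` AT THE PARTITION OF RECORD, BLOCK `s` TO BLOCK `t`, PRINT'S DECAY, MEMBER- AND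
□-UNIFORM CONSTANT** (dag-n06-w7's `hHSuW` body): `G ≤ U(N)`, `N ≥ 1`, `0 ≤ c₀·M·α₀`, `c₀·M·α₀·(d+1) ≤ 1∕16`, `U ∈ Reg335 c₀ α₀`; a cube `c` such that every
plaquette variable within two lattice steps of `□̃(c)` is within `w₀∕L^{2j_D}` of `1` (`j_D = (j(c) − 1) + 2`, `w₀ ≥ 0`); then for all directions `ν μ`, blocks
`s t` and `λ` carried by `Δ(s)`: `Σ_{z∈Δ(t)} HS((M_{h_c}G′_c(U)M_{h_c}∇\*_ν∇\*_μλ)(z)) ≤ C₃ᵘ ∕ (e^{δ₀((d_T(t,s)−m)∕(2L)−1)})²·‖λ‖²₁`, `m = (d+1)(4L+1) + 3`,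
`δ₀ = 1∕(4(d+2))`, `C₃ᵘ(d, L, C₁, C₂, sLip, w₀)` displayed (file 32 `hs_block_sandwich_cdsS_cdsS_le` at `h := hTY c`, `D := cubeDomY x c`, sizes §2, window levels §1,
pointwise window `ε z := Σ_{μν}‖U(∂p_{μν}(z)) − 1‖`).
[cite: Balaban1985BackgroundPropagators, Cor 3.6 p.408, Thm 3.1 (3.46) p.398, (3.87)–(3.89) p.409, (3.35) p.396, (3.69) p.404; Balaban1984PropagatorsII, (2.46) p.231, p.235, p.247; Agmon1982, Ch.1, Thm 1.5] -/
theorem hs_block_hTY_sandwich_cdsS_cdsS_le_window [Nonempty (Fin N)] (hG : G ≤ B7Prop2Explicit.unitaryUnits (Matrix (Fin N) (Fin N) ℂ))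
    {U : CfgY (Matrix (Fin N) (Fin N) ℂ) x.toKIdx} {c₀ α₀ : ℝ} (hC0 : 0 ≤ c₀ * (geo9Y x).M * α₀) (hC1 : c₀ * (geo9Y x).M * α₀ * ((d : ℝ) + 1) ≤ 1 / 16)
    (hreg : (bg9K (Matrix (Fin N) (Fin N) ℂ) G x.toKIdx).Reg335 c₀ α₀ U) (c : ↥(cubes x.toKIdx.D.toDomains)) {w₀ : ℝ} (hw₀ : 0 ≤ w₀)
    (hW : ∀ z : SiteY x.toKIdx, ((∃ μ, shiftY x.toKIdx μ z ∈ cubeDomY x c) ∨ (∃ μ ν, shiftY x.toKIdx ν (shiftY x.toKIdx μ z) ∈ cubeDomY x c)) →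
      ∀ μ ν : Fin (d + 1), ‖((plaqU (shiftY x.toKIdx) (UboxY x.toKIdx U) μ ν z : (Matrix (Fin N) (Fin N) ℂ)ˣ) : Matrix (Fin N) (Fin N) ℂ) - 1‖
        ≤ w₀ / ((((ℓ + 1) ^ (c.1.1 - 1 + 2) : ℕ) : ℝ)) ^ 2)
    (ν μ : Fin (d + 1)) (s t : BlkY x.toKIdx) {Λ : SiteY x.toKIdx → Matrix (Fin N) (Fin N) ℂ} (hΛ : ∀ z, blkOf x.toKIdx.D.toDomains z ≠ s → Λ z = 0) :
    ∑ z ∈ Finset.univ.filter (fun z : SiteY x.toKIdx => blkOf x.toKIdx.D.toDomains z = t), ∑ a, ∑ b,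
        ‖cutMulY (hTY x.toKIdx c) (GsqY x.toKIdx (parSymY x.toKIdx) (cubeDomY x c) U
          (cutMulY (hTY x.toKIdx c) (cdsS x.toKIdx U ν (cdsS x.toKIdx U μ Λ)))) z a b‖ ^ 2
      ≤ 4 / 3 * (4 + 8 * (2560 * ((d : ℝ) + 1) * (5 / 8 * C1F d ℓ * (((ℓ + 1 : ℕ) : ℝ))) ^ 2 + 1024 * ((d : ℝ) + 1) ^ 2 * (25 / 64 * C2F d ℓ * (((ℓ + 1 : ℕ) : ℝ)) ^ 2) ^ 2
              + 512 * sLipT d ℓ ^ 2 * (((ℓ + 1 : ℕ) : ℝ)) ^ 8)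
            + 3072 * (((ℓ + 1 : ℕ) : ℝ)) ^ 8 + 2048 * ((d : ℝ) + 1) ^ 2 * (((d : ℝ) + 1) ^ 2 * w₀) ^ 2
            + 2 * ((d : ℝ) + 1) * (((d : ℝ) + 1) ^ 2 * w₀) * (960 + 1536 * ((d : ℝ) + 1) * (5 / 8 * C1F d ℓ * (((ℓ + 1 : ℕ) : ℝ))) ^ 2 + 2048 * ((d : ℝ) + 1) * (((ℓ + 1 : ℕ) : ℝ)) ^ 8)
            + 256 * ((d : ℝ) + 1) * (((ℓ + 1 : ℕ) : ℝ)) ^ 8 * (320 + 512 * ((d : ℝ) + 1) * (5 / 8 * C1F d ℓ * (((ℓ + 1 : ℕ) : ℝ))) ^ 2)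
            + 16384 * ((d : ℝ) + 1) ^ 2 * (((ℓ + 1 : ℕ) : ℝ)) ^ 16)
          / Real.exp ((1 / (4 * ((d : ℝ) + 2))) * (((((bondT x.toKIdx.D).dist t s : ℕ) : ℝ) - (((((d + 1) * (4 * (ℓ + 1) + 1)) + 3 : ℕ)) : ℝ)) / (2 * ((ℓ + 1 : ℕ) : ℝ)) - 1)) ^ 2
        * trIP (fun _ => (1 : ℝ)) Λ Λ := by
  classical
  -- abbreviations (only for readability of the hypotheses; the constants stay in the goal)
  have hP0 : (0 : ℝ) < ((((ℓ + 1) ^ (c.1.1 - 1 + 2) : ℕ) : ℝ)) := pow_window_pos (ℓ := ℓ) c.1.1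
  have hQ0 : (0 : ℝ) < ((((ℓ + 1) ^ (c.1.1 - 1) : ℕ) : ℝ)) := Nat.cast_pos.2 (pow_pos (Nat.succ_pos ℓ) _)
  have hLr0 : (0 : ℝ) < (((ℓ + 1 : ℕ) : ℝ)) := by exact_mod_cast Nat.succ_pos ℓ
  -- the hypotheses of file 32 at `h := hTY c`, `D := cubeDomY x c`
  have hh1 : ∀ z, |hTY x.toKIdx c z| ≤ 1 := abs_hTY_le_one x.toKIdx c
  have hhκ : ∀ μ' z, |hTY x.toKIdx c (shiftY x.toKIdx μ' z) - hTY x.toKIdx c z|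
      ≤ 5 / 8 * C1F d ℓ * (((ℓ + 1 : ℕ) : ℝ)) / ((((ℓ + 1) ^ (c.1.1 - 1 + 2) : ℕ) : ℝ)) := abs_hTY_shiftY_sub_le_scaled x c
  have hhκ₂ : ∀ μ' z, |hTY x.toKIdx c (shiftY x.toKIdx μ' z) + hTY x.toKIdx c ((shiftY x.toKIdx μ').symm z) - 2 * hTY x.toKIdx c z|
      ≤ 25 / 64 * C2F d ℓ * (((ℓ + 1 : ℕ) : ℝ)) ^ 2 / ((((ℓ + 1) ^ (c.1.1 - 1 + 2) : ℕ) : ℝ)) ^ 2 := abs_hTY_second_diff_le_scaled x c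
  have hhb : ∀ z w : SiteY x.toKIdx, blkOf x.toKIdx.D.toDomains w = blkOf x.toKIdx.D.toDomains z → |hTY x.toKIdx c z - hTY x.toKIdx c w| ≤ sLipT d ℓ :=
    fun z w hzw => abs_hTY_sub_le_sLipT x c hzw
  have hhD : ∀ z, z ∉ cubeDomY x c → hTY x.toKIdx c z = 0 := fun z hz => hTY_eq_zero_of_not_mem_cubeDomY x c hz
  have hjD : ∀ z ∈ cubeDomY x c, (blkOf x.toKIdx.D.toDomains z).1.1 ≤ c.1.1 - 1 + 2 := fun z hz => (lev_window_of_mem_cubeDomY x c hz).2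
  have hjD' : ∀ z ∈ cubeDomY x c, c.1.1 - 1 ≤ (blkOf x.toKIdx.D.toDomains z).1.1 := fun z hz => (lev_window_of_mem_cubeDomY x c hz).1
  -- the pointwise window `ε z := Σ_{μν} ‖U(∂p_{μν}(z)) − 1‖` and its size near `□̃(c)`
  have hε0 : ∀ z : SiteY x.toKIdx, 0 ≤ ∑ μ' : Fin (d + 1), ∑ ν' : Fin (d + 1),
      ‖((plaqU (shiftY x.toKIdx) (UboxY x.toKIdx U) μ' ν' z : (Matrix (Fin N) (Fin N) ℂ)ˣ) : Matrix (Fin N) (Fin N) ℂ) - 1‖ :=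
    fun z => Finset.sum_nonneg fun μ' _ => Finset.sum_nonneg fun ν' _ => norm_nonneg _
  have hF : ∀ (μ' ν' : Fin (d + 1)) (z : SiteY x.toKIdx),
      ‖((plaqU (shiftY x.toKIdx) (UboxY x.toKIdx U) μ' ν' z : (Matrix (Fin N) (Fin N) ℂ)ˣ) : Matrix (Fin N) (Fin N) ℂ) - 1‖
        ≤ ∑ μ'' : Fin (d + 1), ∑ ν'' : Fin (d + 1),
            ‖((plaqU (shiftY x.toKIdx) (UboxY x.toKIdx U) μ'' ν'' z : (Matrix (Fin N) (Fin N) ℂ)ˣ) : Matrix (Fin N) (Fin N) ℂ) - 1‖ := by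
    intro μ' ν' z
    calc ‖((plaqU (shiftY x.toKIdx) (UboxY x.toKIdx U) μ' ν' z : (Matrix (Fin N) (Fin N) ℂ)ˣ) : Matrix (Fin N) (Fin N) ℂ) - 1‖
        ≤ ∑ ν'' : Fin (d + 1), ‖((plaqU (shiftY x.toKIdx) (UboxY x.toKIdx U) μ' ν'' z : (Matrix (Fin N) (Fin N) ℂ)ˣ) : Matrix (Fin N) (Fin N) ℂ) - 1‖ :=
          Finset.single_le_sum (f := fun ν'' => ‖((plaqU (shiftY x.toKIdx) (UboxY x.toKIdx U) μ' ν'' z : (Matrix (Fin N) (Fin N) ℂ)ˣ) : Matrix (Fin N) (Fin N) ℂ) - 1‖)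
            (fun ν'' _ => norm_nonneg _) (Finset.mem_univ ν')
      _ ≤ ∑ μ'' : Fin (d + 1), ∑ ν'' : Fin (d + 1),
            ‖((plaqU (shiftY x.toKIdx) (UboxY x.toKIdx U) μ'' ν'' z : (Matrix (Fin N) (Fin N) ℂ)ˣ) : Matrix (Fin N) (Fin N) ℂ) - 1‖ :=
          Finset.single_le_sum (f := fun μ'' => ∑ ν'' : Fin (d + 1),
              ‖((plaqU (shiftY x.toKIdx) (UboxY x.toKIdx U) μ'' ν'' z : (Matrix (Fin N) (Fin N) ℂ)ˣ) : Matrix (Fin N) (Fin N) ℂ) - 1‖)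
            (fun μ'' _ => Finset.sum_nonneg fun ν'' _ => norm_nonneg _) (Finset.mem_univ μ')
  have hεle : ∀ z : SiteY x.toKIdx, ((∃ μ, shiftY x.toKIdx μ z ∈ cubeDomY x c) ∨ (∃ μ ν, shiftY x.toKIdx ν (shiftY x.toKIdx μ z) ∈ cubeDomY x c)) →
      ∑ μ' : Fin (d + 1), ∑ ν' : Fin (d + 1),
          ‖((plaqU (shiftY x.toKIdx) (UboxY x.toKIdx U) μ' ν' z : (Matrix (Fin N) (Fin N) ℂ)ˣ) : Matrix (Fin N) (Fin N) ℂ) - 1‖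
        ≤ ((d : ℝ) + 1) ^ 2 * w₀ / ((((ℓ + 1) ^ (c.1.1 - 1 + 2) : ℕ) : ℝ)) ^ 2 := by
    intro z hz
    calc ∑ μ' : Fin (d + 1), ∑ ν' : Fin (d + 1),
          ‖((plaqU (shiftY x.toKIdx) (UboxY x.toKIdx U) μ' ν' z : (Matrix (Fin N) (Fin N) ℂ)ˣ) : Matrix (Fin N) (Fin N) ℂ) - 1‖
        ≤ ∑ μ' : Fin (d + 1), ∑ ν' : Fin (d + 1), w₀ / ((((ℓ + 1) ^ (c.1.1 - 1 + 2) : ℕ) : ℝ)) ^ 2 :=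
          Finset.sum_le_sum fun μ' _ => Finset.sum_le_sum fun ν' _ => hW z hz μ' ν'
      _ = ((d : ℝ) + 1) ^ 2 * w₀ / ((((ℓ + 1) ^ (c.1.1 - 1 + 2) : ℕ) : ℝ)) ^ 2 := by
          simp only [Finset.sum_const, Finset.card_univ, Fintype.card_fin]
          push_cast
          ring
  have hεD0 : 0 ≤ ((d : ℝ) + 1) ^ 2 * w₀ / ((((ℓ + 1) ^ (c.1.1 - 1 + 2) : ℕ) : ℝ)) ^ 2 := by positivity
  have hεD : ∀ (z : SiteY x.toKIdx) (μ' ν' : Fin (d + 1)), shiftY x.toKIdx ν' (shiftY x.toKIdx μ' z) ∈ cubeDomY x c →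
      ∑ μ'' : Fin (d + 1), ∑ ν'' : Fin (d + 1),
          ‖((plaqU (shiftY x.toKIdx) (UboxY x.toKIdx U) μ'' ν'' z : (Matrix (Fin N) (Fin N) ℂ)ˣ) : Matrix (Fin N) (Fin N) ℂ) - 1‖
        ≤ ((d : ℝ) + 1) ^ 2 * w₀ / ((((ℓ + 1) ^ (c.1.1 - 1 + 2) : ℕ) : ℝ)) ^ 2 :=
    fun z μ' ν' h => hεle z (Or.inr ⟨μ', ν', h⟩)
  have hεD' : ∀ (z : SiteY x.toKIdx) (μ' : Fin (d + 1)), shiftY x.toKIdx μ' z ∈ cubeDomY x c →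
      ∑ μ'' : Fin (d + 1), ∑ ν'' : Fin (d + 1),
          ‖((plaqU (shiftY x.toKIdx) (UboxY x.toKIdx U) μ'' ν'' z : (Matrix (Fin N) (Fin N) ℂ)ˣ) : Matrix (Fin N) (Fin N) ℂ) - 1‖
        ≤ ((d : ℝ) + 1) ^ 2 * w₀ / ((((ℓ + 1) ^ (c.1.1 - 1 + 2) : ℕ) : ℝ)) ^ 2 :=
    fun z μ' h => hεle z (Or.inl ⟨μ', h⟩)
  -- file 32 at the pins
  have key := hs_block_sandwich_cdsS_cdsS_le x.toKIdx hG hC0 hC1 hreg (cubeDomY x c) hh1 hhκ hhκ₂ hhb hhD hjD hjD'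
    (ε := fun z => ∑ μ' : Fin (d + 1), ∑ ν' : Fin (d + 1),
      ‖((plaqU (shiftY x.toKIdx) (UboxY x.toKIdx U) μ' ν' z : (Matrix (Fin N) (Fin N) ℂ)ˣ) : Matrix (Fin N) (Fin N) ℂ) - 1‖)
    (εD := ((d : ℝ) + 1) ^ 2 * w₀ / ((((ℓ + 1) ^ (c.1.1 - 1 + 2) : ℕ) : ℝ)) ^ 2) hε0 hεD0 hF hεD hεD' ν μ s t hΛ
  -- uniformization: `L^{j_D} = L²·L^{j′_D}`, then every product cancels
  rw [pow_window_eq (ℓ := ℓ) c.1.1] at key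
  rw [const_identity (5 / 8 * C1F d ℓ * (((ℓ + 1 : ℕ) : ℝ))) (25 / 64 * C2F d ℓ * (((ℓ + 1 : ℕ) : ℝ)) ^ 2) (sLipT d ℓ) (((d : ℝ) + 1) ^ 2 * w₀)
    (((ℓ + 1 : ℕ) : ℝ)) ((((ℓ + 1) ^ (c.1.1 - 1) : ℕ) : ℝ)) ((d : ℝ) + 1) hLr0.ne' hQ0.ne'] at key
  exact key

end Main

/-! ## §4 The schema `L2SecondLegs37` at the pins, under the located window binder -/

section Packaging

/-- ★★★ **ROWS 18's `L2SecondLegs37` AT THE PINS, MODULO THE PLAQUETTE WINDOW NEAR `□̃`** (dag-n06-w7's §5 `l2SecondLegs37_memberY_of_hs_window` fed by §3):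
`∃ M₃ a₃ B₃ δ₃ > 0` such that, for every `G ≤ U(N)`, every member `x` with `M₃ ≤ M`, `0 < α₀`, `c₀Mα₀ ≤ a₃`, every `U` of the class `Reg335 c₀ α₀` whose plaquette
variables within two lattice steps of each `□̃(c)` are within `w₀∕L^{2((j(c)−1)+2)}` of `1`, and the certificate's pins (`blk = blkSK (sIK bI)`, `h = hWalkY`,
`Gsq = gsqcoS`, `Dsd = η⁻¹ • coordOpK (cdsSL)`): `L2SecondLegs37 𝔬 𝔡 R₀ H₀ (SblkY x bI) B₃ δ₃ U`.
[cite: Balaban1985BackgroundPropagators, Cor 3.6 p.408, Thm 3.1 (3.46) p.398, (3.87)–(3.90) pp.409–410, (3.35) p.396, (3.69) p.404; Balaban1984PropagatorsII, (2.46) p.231, (2.51)–(2.54) pp.232–233, Lemma 2.1 (2.61) p.234, p.235, p.247] -/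
theorem l2SecondLegs37_memberY_window (d ℓ : ℕ) (hd : 1 ≤ d + 1) (hL : Odd (ℓ + 1) ∧ 1 < ℓ + 1) (b₀ b₁ : ℝ) (Mstar N : ℕ) [NeZero N] {c₀ : ℝ} (hc₀ : 0 < c₀)
    {w₀ : ℝ} (hw₀ : 0 ≤ w₀) :
    ∃ M3 a3 B3 δ3 : ℝ, 0 < M3 ∧ 0 < a3 ∧ 0 < B3 ∧ 0 < δ3 ∧
      ∀ {G : Subgroup (Matrix (Fin N) (Fin N) ℂ)ˣ} (_ : G ≤ B7Prop2Explicit.unitaryUnits (Matrix (Fin N) (Fin N) ℂ))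
        (x : MemberY d ℓ hd hL b₀ b₁ Mstar), M3 ≤ (geo9Y x).M → ∀ α₀ : ℝ, 0 < α₀ → c₀ * (geo9Y x).M * α₀ ≤ a3 →
      ∀ (U : (bg9Y (Matrix (Fin N) (Fin N) ℂ) G x).Cfg), (bg9Y (Matrix (Fin N) (Fin N) ℂ) G x).Reg335 c₀ α₀ U →
      (∀ (c : ↥(cubes x.toKIdx.D.toDomains)) (z : SiteY x.toKIdx),
          ((∃ μ, shiftY x.toKIdx μ z ∈ cubeDomY x c) ∨ (∃ μ ν, shiftY x.toKIdx ν (shiftY x.toKIdx μ z) ∈ cubeDomY x c)) →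
          ∀ μ ν : Fin (d + 1), ‖((plaqU (shiftY x.toKIdx) (UboxY x.toKIdx U) μ ν z : (Matrix (Fin N) (Fin N) ℂ)ˣ) : Matrix (Fin N) (Fin N) ℂ) - 1‖
            ≤ w₀ / ((((ℓ + 1) ^ (c.1.1 - 1 + 2) : ℕ) : ℝ)) ^ 2) →
      ∀ {bI : FBondY x.toKIdx → IBondY x.toKIdx} (_ : ∀ f, lvl x.hN x.D x.hk (bI f) = (blkV1 x.hN x.D f).1.1)
        (_ : ∀ f, (geomT x.D).dist (β x.hN x.D x.hk (bI f)) (blkV1 x.hN x.D f) ≤ 1) (R₀ : ℝ) (H₀ : Prop) [Fintype (geo9Y x).Site] [DecidableEq (geo9Y x).Site]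
        {Y : Type} (𝔬 : Ops (geo9Y x) (bg9Y (Matrix (Fin N) (Fin N) ℂ) G x) (XSK (TrIdx N) x.toKIdx) Y ↥(cubes x.toKIdx.D.toDomains)) (𝔡 : DirOps37 𝔬 (Fin (d + 1)))
        (_ : 𝔬.blk = blkSK x.toKIdx (sIK x.toKIdx bI)) (_ : ∀ c, 𝔬.h c = hWalkY x c)
        (_ : ∀ c, 𝔬.Gsq U c = gsqcoS x (trBasis N) (bg9Y (Matrix (Fin N) (Fin N) ℂ) G x) (fun U => U) (parSymY x.toKIdx) c U)
        (_ : ∀ μ, 𝔡.Dsd U μ = (etaS x.toKIdx)⁻¹ • coordOpK (trBasis N) (fun _ : Fin (d + 1) => (cdsSL x.toKIdx U μ).restrictScalars ℝ)),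
        L2SecondLegs37 𝔬 𝔡 R₀ H₀ (SblkY x bI) B3 δ3 U := by
  have hC3 : (0 : ℝ) ≤ 4 / 3 * (4 + 8 * (2560 * ((d : ℝ) + 1) * (5 / 8 * C1F d ℓ * (((ℓ + 1 : ℕ) : ℝ))) ^ 2 + 1024 * ((d : ℝ) + 1) ^ 2 * (25 / 64 * C2F d ℓ * (((ℓ + 1 : ℕ) : ℝ)) ^ 2) ^ 2
              + 512 * sLipT d ℓ ^ 2 * (((ℓ + 1 : ℕ) : ℝ)) ^ 8)
            + 3072 * (((ℓ + 1 : ℕ) : ℝ)) ^ 8 + 2048 * ((d : ℝ) + 1) ^ 2 * (((d : ℝ) + 1) ^ 2 * w₀) ^ 2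
            + 2 * ((d : ℝ) + 1) * (((d : ℝ) + 1) ^ 2 * w₀) * (960 + 1536 * ((d : ℝ) + 1) * (5 / 8 * C1F d ℓ * (((ℓ + 1 : ℕ) : ℝ))) ^ 2 + 2048 * ((d : ℝ) + 1) * (((ℓ + 1 : ℕ) : ℝ)) ^ 8)
            + 256 * ((d : ℝ) + 1) * (((ℓ + 1 : ℕ) : ℝ)) ^ 8 * (320 + 512 * ((d : ℝ) + 1) * (5 / 8 * C1F d ℓ * (((ℓ + 1 : ℕ) : ℝ))) ^ 2)
            + 16384 * ((d : ℝ) + 1) ^ 2 * (((ℓ + 1 : ℕ) : ℝ)) ^ 16) := by positivity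
  exact l2SecondLegs37_memberY_of_hs_window d ℓ hd hL b₀ b₁ Mstar N hc₀ (m := (((((d + 1) * (4 * (ℓ + 1) + 1)) + 3 : ℕ)) : ℝ)) hC3
    (fun x U c => ∀ z : SiteY x.toKIdx, ((∃ μ, shiftY x.toKIdx μ z ∈ cubeDomY x c) ∨ (∃ μ ν, shiftY x.toKIdx ν (shiftY x.toKIdx μ z) ∈ cubeDomY x c)) →
      ∀ μ ν : Fin (d + 1), ‖((plaqU (shiftY x.toKIdx) (UboxY x.toKIdx U) μ ν z : (Matrix (Fin N) (Fin N) ℂ)ˣ) : Matrix (Fin N) (Fin N) ℂ) - 1‖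
        ≤ w₀ / ((((ℓ + 1) ^ (c.1.1 - 1 + 2) : ℕ) : ℝ)) ^ 2)
    (fun hG x U α₀ hC0 hC1 hreg c hWc ν μ s t Λ hΛ => by
      haveI : Nonempty (Fin N) := ⟨⟨0, Nat.pos_of_ne_zero (NeZero.ne N)⟩⟩
      exact hs_block_hTY_sandwich_cdsS_cdsS_le_window x hG hC0 hC1 hreg c hw₀ hWc ν μ s t hΛ)

end Packaging

/-! ## §5 (v1.1, append-only) The window from a LEVELLED bound on def-Y's plaquette variables — the shape of node00-def-Y's ruling R-W0 -/

section Levelled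
/-- ★ **A LEVELLED WINDOW ON def-Y's PLAQUETTE VARIABLES GIVES §3's PER-CUBE WINDOW WITH A UNIFORM SCALE** (node00-def-Y R-W0's shape: (3.35) on the covering
cube at `ξ = L^{j′}η ≥ L^{lev x − 1}η`): `‖U(∂p) − 1‖ ≤ C₀·(L^{lev(p.src) − 1})⁻²` at every plaquette gives, for every cube `c`, site `z` with `z + e_μ ∈ □̃(c)` or `z + e_μ + e_ν ∈ □̃(c)`
and all directions, `‖U(∂p_{μν}(z)) − 1‖ ≤ C₀L¹⁰∕L^{2((j(c)−1)+2)}` (`norm_plaqU_sub_one_le_of_holY`; two steps cost ≤ 2 levels by `lev_shiftY_le`, so `lev z ≥ j(c) − 3`).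
[cite: Balaban1985BackgroundPropagators, (3.35) p.396, (3.69) p.404, (3.1) p.390; Balaban1984PropagatorsII, p.235, (2.2) p.224] -/
theorem window_of_levelled_holY (hG : G ≤ B7Prop2Explicit.unitaryUnits (Matrix (Fin N) (Fin N) ℂ)) {U : CfgY (Matrix (Fin N) (Fin N) ℂ) x.toKIdx}
    (hU : ∀ μ z, U μ z ∈ G) {C₀ : ℝ} (hC₀ : 0 ≤ C₀)
    (hlev : ∀ p : PlaqY x.toKIdx, ‖((holY x.toKIdx U p : (Matrix (Fin N) (Fin N) ℂ)ˣ) : Matrix (Fin N) (Fin N) ℂ) - 1‖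
      ≤ C₀ * (((kGeo x.toKIdx).L ^ (levV1 x.toKIdx p.src - 1))⁻¹) ^ 2)
    (c : ↥(cubes x.toKIdx.D.toDomains)) (z : SiteY x.toKIdx)
    (hz : (∃ μ, shiftY x.toKIdx μ z ∈ cubeDomY x c) ∨ (∃ μ ν, shiftY x.toKIdx ν (shiftY x.toKIdx μ z) ∈ cubeDomY x c)) (μ ν : Fin (d + 1)) :
    ‖((plaqU (shiftY x.toKIdx) (UboxY x.toKIdx U) μ ν z : (Matrix (Fin N) (Fin N) ℂ)ˣ) : Matrix (Fin N) (Fin N) ℂ) - 1‖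
      ≤ C₀ * (((ℓ + 1 : ℕ) : ℝ)) ^ 10 / ((((ℓ + 1) ^ (c.1.1 - 1 + 2) : ℕ) : ℝ)) ^ 2 := by
  have hwin := B9Thm31SiteCurvatureCommutatorsY.norm_plaqU_sub_one_le_of_holY x.toKIdx hG hU
    (ε := fun z : SiteY x.toKIdx => C₀ * (((kGeo x.toKIdx).L ^ ((blkOf x.toKIdx.D.toDomains z).1.1 - 1))⁻¹) ^ 2) (fun z => by positivity) (fun p => hlev p) μ ν z
  refine hwin.trans ?_
  have hl : c.1.1 ≤ (blkOf x.toKIdx.D.toDomains z).1.1 + 3 := by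
    rcases hz with ⟨μ', h⟩ | ⟨μ', ν', h⟩
    · have h1 := (lev_window_of_mem_cubeDomY x c h).1
      have h2 := B9Thm31SiteBlockBumpY.lev_shiftY_le x.toKIdx μ' z
      omega
    · have h1 := (lev_window_of_mem_cubeDomY x c h).1
      have h2 := B9Thm31SiteBlockBumpY.lev_shiftY_le x.toKIdx μ' z
      have h3 := B9Thm31SiteBlockBumpY.lev_shiftY_le x.toKIdx ν' (shiftY x.toKIdx μ' z)
      omega
  have hLr : (kGeo x.toKIdx).L = (((ℓ + 1 : ℕ) : ℝ)) := rfl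
  have hP : (0 : ℝ) < ((((ℓ + 1) ^ (c.1.1 - 1 + 2) : ℕ) : ℝ)) := pow_window_pos (ℓ := ℓ) c.1.1
  have hQ : (0 : ℝ) < (((ℓ + 1 : ℕ) : ℝ)) ^ ((blkOf x.toKIdx.D.toDomains z).1.1 - 1) := pow_pos (Nat.cast_pos.2 (Nat.succ_pos ℓ)) _
  have hnat : (ℓ + 1) ^ (c.1.1 - 1 + 2) * (ℓ + 1) ^ (c.1.1 - 1 + 2)
      ≤ (ℓ + 1) ^ 10 * ((ℓ + 1) ^ ((blkOf x.toKIdx.D.toDomains z).1.1 - 1) * (ℓ + 1) ^ ((blkOf x.toKIdx.D.toDomains z).1.1 - 1)) := by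
    rw [← pow_add, ← pow_add, ← pow_add]
    exact Nat.pow_le_pow_right (Nat.succ_pos ℓ) (by omega)
  have hreal : ((((ℓ + 1) ^ (c.1.1 - 1 + 2) : ℕ) : ℝ)) ^ 2
      ≤ (((ℓ + 1 : ℕ) : ℝ)) ^ 10 * ((((ℓ + 1 : ℕ) : ℝ)) ^ ((blkOf x.toKIdx.D.toDomains z).1.1 - 1)) ^ 2 := by
    rw [sq, sq]; exact_mod_cast hnat
  rw [hLr, inv_pow, ← one_div, mul_one_div, div_le_div_iff₀ (pow_pos hQ 2) (pow_pos hP 2)]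
  calc C₀ * ((((ℓ + 1) ^ (c.1.1 - 1 + 2) : ℕ) : ℝ)) ^ 2 ≤ C₀ * ((((ℓ + 1 : ℕ) : ℝ)) ^ 10 * ((((ℓ + 1 : ℕ) : ℝ)) ^ ((blkOf x.toKIdx.D.toDomains z).1.1 - 1)) ^ 2) :=
        mul_le_mul_of_nonneg_left hreal hC₀
    _ = C₀ * (((ℓ + 1 : ℕ) : ℝ)) ^ 10 * ((((ℓ + 1 : ℕ) : ℝ)) ^ ((blkOf x.toKIdx.D.toDomains z).1.1 - 1)) ^ 2 := by ring

/-- ★★★ **ROWS 18's `L2SecondLegs37` AT THE PINS FROM A LEVELLED PLAQUETTE BOUND IN def-Y's LETTERS** (§4 with the per-cube window DISCHARGED by `window_of_levelled_holY`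
at `w₀ = C₀L¹⁰`): `∃ M₃ a₃ B₃ δ₃ > 0`, for every `G ≤ U(N)`, member `x` with `M₃ ≤ M`, `0 < α₀`, `c₀Mα₀ ≤ a₃`, every `U` of `Reg335 c₀ α₀` with `‖U(∂p) − 1‖ ≤ C₀·(L^{lev(p.src)−1})⁻²`
at every plaquette, and the certificate's pins: `L2SecondLegs37 𝔬 𝔡 R₀ H₀ (SblkY x bI) B₃ δ₃ U`.
[cite: Balaban1985BackgroundPropagators, Cor 3.6 p.408, Thm 3.1 (3.46) p.398, (3.87)–(3.90) pp.409–410, (3.35) p.396, (3.69) p.404; Balaban1984PropagatorsII, (2.46) p.231, (2.51)–(2.54) pp.232–233, Lemma 2.1 (2.61) p.234, p.235, p.247] -/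
theorem l2SecondLegs37_memberY_levelled (d ℓ : ℕ) (hd : 1 ≤ d + 1) (hL : Odd (ℓ + 1) ∧ 1 < ℓ + 1) (b₀ b₁ : ℝ) (Mstar N : ℕ) [NeZero N] {c₀ : ℝ} (hc₀ : 0 < c₀)
    {C₀ : ℝ} (hC₀ : 0 ≤ C₀) :
    ∃ M3 a3 B3 δ3 : ℝ, 0 < M3 ∧ 0 < a3 ∧ 0 < B3 ∧ 0 < δ3 ∧
      ∀ {G : Subgroup (Matrix (Fin N) (Fin N) ℂ)ˣ} (_ : G ≤ B7Prop2Explicit.unitaryUnits (Matrix (Fin N) (Fin N) ℂ))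
        (x : MemberY d ℓ hd hL b₀ b₁ Mstar), M3 ≤ (geo9Y x).M → ∀ α₀ : ℝ, 0 < α₀ → c₀ * (geo9Y x).M * α₀ ≤ a3 →
      ∀ (U : (bg9Y (Matrix (Fin N) (Fin N) ℂ) G x).Cfg), (bg9Y (Matrix (Fin N) (Fin N) ℂ) G x).Reg335 c₀ α₀ U →
      (∀ p : PlaqY x.toKIdx, ‖((holY x.toKIdx U p : (Matrix (Fin N) (Fin N) ℂ)ˣ) : Matrix (Fin N) (Fin N) ℂ) - 1‖
          ≤ C₀ * (((kGeo x.toKIdx).L ^ (levV1 x.toKIdx p.src - 1))⁻¹) ^ 2) →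
      ∀ {bI : FBondY x.toKIdx → IBondY x.toKIdx} (_ : ∀ f, lvl x.hN x.D x.hk (bI f) = (blkV1 x.hN x.D f).1.1)
        (_ : ∀ f, (geomT x.D).dist (β x.hN x.D x.hk (bI f)) (blkV1 x.hN x.D f) ≤ 1) (R₀ : ℝ) (H₀ : Prop) [Fintype (geo9Y x).Site] [DecidableEq (geo9Y x).Site]
        {Y : Type} (𝔬 : Ops (geo9Y x) (bg9Y (Matrix (Fin N) (Fin N) ℂ) G x) (XSK (TrIdx N) x.toKIdx) Y ↥(cubes x.toKIdx.D.toDomains)) (𝔡 : DirOps37 𝔬 (Fin (d + 1)))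
        (_ : 𝔬.blk = blkSK x.toKIdx (sIK x.toKIdx bI)) (_ : ∀ c, 𝔬.h c = hWalkY x c)
        (_ : ∀ c, 𝔬.Gsq U c = gsqcoS x (trBasis N) (bg9Y (Matrix (Fin N) (Fin N) ℂ) G x) (fun U => U) (parSymY x.toKIdx) c U)
        (_ : ∀ μ, 𝔡.Dsd U μ = (etaS x.toKIdx)⁻¹ • coordOpK (trBasis N) (fun _ : Fin (d + 1) => (cdsSL x.toKIdx U μ).restrictScalars ℝ)),
        L2SecondLegs37 𝔬 𝔡 R₀ H₀ (SblkY x bI) B3 δ3 U := by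
  have hw₀ : 0 ≤ C₀ * (((ℓ + 1 : ℕ) : ℝ)) ^ 10 := by positivity
  obtain ⟨M3, a3, B3, δ3, hM3, ha3, hB3, hδ3, H⟩ := l2SecondLegs37_memberY_window d ℓ hd hL b₀ b₁ Mstar N hc₀ hw₀
  refine ⟨M3, a3, B3, δ3, hM3, ha3, hB3, hδ3, ?_⟩
  intro G hG x hM α₀ hα₀ ha U hU hlev bI hlev1 hβ1 R₀ H₀ _ _ Y 𝔬 𝔡 hblk hh hGsq hDsd
  have hreg : (bg9K (Matrix (Fin N) (Fin N) ℂ) G x.toKIdx).Reg335 c₀ α₀ U := ((reg335Y_iff x c₀ α₀ U).1 hU).1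
  exact H hG x hM α₀ hα₀ ha U hU (fun c z hz μ ν => window_of_levelled_holY x hG hreg.1 hC₀ hlev c z hz μ ν) hlev1 hβ1 R₀ H₀ 𝔬 𝔡 hblk hh hGsq hDsd
end Levelled

end Literature.MathematicalPhysics.QuantumFieldTheory.Balaban1983to89.B9Eq346SecondLegAtCubesTorusL2

end
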